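import Mathlib.Algebra.BigOperators.Ring.Finset
import Mathlib.Algebra.Order.BigOperators.Group.Finset
import Mathlib.Data.Real.Basic
import Mathlib.Data.Finset.Sym
import Mathlib.Data.Sym.Card
import Mathlib.Data.Fintype.Powerset
import Mathlib.Algebra.Ring.Parity
import HarnessLib

/-!
# Potechin's "good story" pseudo-expectation for the MOD 2 principle (perfect matchings of `K_n`, `n` odd):
# the symmetric pseudo-matching moments are positive semidefinite up to index degree `n`

Source: A. Potechin, *Sum of Squares Lower Bounds from Symmetry and a Good Story*, ITCS 2019, LIPIcs 124,
61:1–61:20 (bib key `Potechin2019`; held text `paper:arxiv-1711.11469`, read first-hand 2026-08-27: Thm 1.2 on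
arXiv p. 4, Def. 2.14 + Remark 2.16 on p. 6, Example 3.4 on p. 7 with its formula at the top of p. 8, Cor. 3.10 on
p. 9, Thm 6.10 / Cor. 6.11 on p. 16).

THE MOD 2 PRINCIPLE (p. 3): variables `x_{ij}` for the edges of `K_n`, equations `x_{ij}² = x_{ij}` and
`Σ_{j ≠ i} x_{ij} = 1` for every vertex `i` — "K_n has a perfect matching", infeasible for odd `n` (the tree's
`Literature.Computability.Complexity.Mod2.system`, module `Mod2SosDegree.lean`, where Grigoriev's linear degree
lower bound for its refutations is recorded and PROVED, `Grigoriev2001_mod2Degree_holds`). THE STORY (Example 3.4):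
"for each vertex `i`, the perfect matching contains precisely one of the edges incident to `i`", giving the
pseudo-expectation values (p. 8, verbatim): "for all `E ⊆ {(i,j) : i < j}` such that `|E| ≤ d`,
`Ẽ[∏_{(i,j) ∈ E} x_{ij}] = 1/∏_{j=1}^{|E|} (n − 2j + 1)` if `E` is a partial matching and `Ẽ[∏_{(i,j) ∈ E} x_{ij}] = 0`
otherwise." THE THEOREM (Thm 1.2: "Degree `(n−1)/2` SOS fails to prove that the equations for the MOD 2 principle are
infeasible"; Cor. 3.10 / Cor. 6.11: "For all odd `n`, index degree `n` SOS fails to refute the equations for the MOD 2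
principle"; proved in §5–§6 via Thm 6.10: the story is a level `(⌊n/2⌋ + 1, n)` good story): for odd `n` these values
are index-degree-`n` pseudo-expectation values (Def. 2.14), in particular (Def. 2.14 (3), Remark 2.16: "the moment
matrix `M` indexed by monomials `p, q` of index degree `≤ d/2`, `M_{pq} = Ẽ[pq]`, is PSD") **`Ẽ[g²] ≥ 0` for every
polynomial `g` of index degree `≤ n/2`**, the index degree of a monomial being the number of vertices it mentions
(Def. 2.11).

This module records that positivity as ONE named fact, `Potechin2019_mod2StoryPSD`, in the combinatorial currency
of its consumer (cell pnp-psdrank, kernel brick `…ChebyshevTracialDesignPseudoMatchingTensor`, p557445: the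
matching-side low-degree pricing of the route `ChebyshevTracialDesign` is proved there MODULO exactly the one-clique
statements below for the odd cliques `K_U`, `K_Ū`): edge sets `G ⊆ Sym2 (Fin n)` (squarefree monomials `x_G`; a
"set" containing a diagonal element `s(a, a)` is never a partial matching and has moment `0`), the STORY MOMENT
`storyMoment n G = [G is a partial matching] · ∏_{j < |G|} (n − 1 − 2j)⁻¹` (= the printed `1/∏_{j=1}^{|G|}(n − 2j + 1)`),
the vertex support `verts G` (index degree of `x_G` = `|verts G|`), and the quadratic form
`δ ↦ Σ_{G,G'} δ_G δ_{G'} · storyMoment n (G ∪ G')` = `Ẽ[g²]` for the multilinear `g = Σ_G δ_G x_G`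
(`x_G x_{G'} ≡ x_{G ∪ G'}` modulo the Boolean axioms, whose multiples `Ẽ` annihilates, Def. 2.14 (2)).

* `Potechin2019_mod2StoryPSD` — NAMED FACT (`def … : Prop`, not proved here; the paper's proof is §5–§6,
  Thm 5.11/5.12 + Thm 6.9/6.10 — see "STATUS OF THE PRINTED PROOF" below: its Lemma 5.13 is false, the statement is
  true, repaired proof in the cell memo LIT-28): for odd `n` and every coefficient vector `δ` supported on edge sets of
  index degree `≤ (n − 1)/2`, `0 ≤ Σ_{G,G'} δ_G δ_{G'} storyMoment n (G ∪ G')`.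
  -- TODO(general form): the printed statement is for ALL polynomials `g` of index degree `≤ n/2` (non-multilinear
  -- monomials included) and asserts the full Def. 2.14 (conditions (1)–(2) as well); only the positivity clause on
  -- multilinear `g` — the moment-matrix PSD statement of Remark 2.16 — is recorded, which is what the consumer uses.
* PROVED API: `storyMoment_of_isPartialMatching` / `storyMoment_of_not_isPartialMatching` (unfolding),
  `storyMoment_empty` (`Ẽ[1] = 1`, Def. 2.14 (1)), `storyMoment_singleton` (`Ẽ[x_{ij}] = 1/(n − 1)`, Example 3.4),
  `card_verts_le_two_mul` (index degree `≤ 2 ·` degree), and the consumer's corollary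
  **`Potechin2019_mod2StoryPSD.of_card_le`**: for odd `n` and `4k + 1 ≤ n` the form is nonnegative on ALL coefficient
  vectors indexed by `{F : |F| ≤ k}` (a degree-`k` multilinear `g` has index degree `≤ 2k ≤ (n − 1)/2`).

presearch: Potechin2019 Thm 1.2 / Cor 3.10 [corpus: paper:arxiv-1711.11469 p. 4, 8, 9, 16] is the source; Grigoriev
2001 (TCS 259) Cor. 2 gives only the EXISTENCE side at degree `c·n` with an inexplicit `c` (tree: `Mod2SosDegree`,
proved) — not the explicit symmetric moments at degree `(n−1)/2`; no Lean formalisation of Potechin's machinery exists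
in the tree (`rg Potechin` under `Literature/`: two prose mentions). Debt note (D-0026): ONE new named fact, requested
by its consumer (eng g13, STATUS 2026-08-27 «@lit: typing target `Potechin2019_mod2StoryPSD`»); its discharge
(`Potechin2019_mod2StoryPSD_holds`) is a separate provefact unit.

## STATUS OF THE PRINTED PROOF (recorded 2026-08-27; the statement above is unchanged and is what is printed)

The printed proof of Thm 1.2 is INCOMPLETE: Thm 5.11 (arXiv p. 13) combines Thm 5.12 with Thm 4.1 through
**Lemma 5.13** ("if `g_{Ij}` is symmetric under `S_{[n]∖I}` and `Σ_{σ ∈ S_{[n]∖(I∖{i})}} σ(g_{Ij}) = 0` for all `i ∈ I`,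
then all monomials in `g_{Ij}` depend on all of the indices in `I`"), and Lemma 5.13 is FALSE — the paper's own
components `φ_{F,L}` of Appendix A (Def. 8.15; e.g. Example 8.17, `φ_{F,(i)} = x_i − (n−1)⁻¹ Σ_{j≠i} x_j`) satisfy
its hypotheses and contain monomials avoiding `I`; the faulty step is "these are also the coefficients of `σ₂(p)` for
`σ₂ ∈ S_{[n]∖(I∖{i})}`" (such `σ₂(p)` may involve `i`). What the printed argument DOES prove is the weaker range
`indexdeg(g) ≤ n/3` (components with `|I| + 2·indexdeg_{[n]∖I}(g_{Ij}) ≤ n`), i.e. for the multilinear edge form below: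
nonnegativity on `{F : |F| ≤ k}` whenever `6k ≤ n` (cell pnp-psdrank, littype-FN2-1 g8, who found the gap, is
landing that range as theorems). No erratum or second proof exists in print (the ten citing works, e.g. Austrin–Risse,
TheoretiCS 2022, p. 4, use only the `Ω(n)` bound). The THEOREM AS STATED IS NEVERTHELESS TRUE: a complete repaired
proof is written out in the cell memo `run/shared/lean/pub/pnp-psdrank/pnp-psdrank-lit/LIT-28.md` (2026-08-27):
(A) RANK-ONE REDUCTION — `Q_n(g) = Ẽ_n[g²]` is `S_n`-invariant and at every EVEN `N` it is the Gram form of evaluation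
into `L²` of the uniform perfect matching of `K_N`, which is multiplicity-free (Gelfand pair `(S_{2a}, B_a)`,
Macdonald, *Symmetric Functions and Hall Polynomials*, VII (2.2)), so by rational continuation in `n` the form has rank
`≤ 1` on every isotypic type `(n − |λ̄|, λ̄)`, vanishes unless `λ̄ = 2ν̄` is even, and is PSD there iff ONE explicit
eigenvalue `θ_ν̄(n)` (of the degree-`|ν̄|` moment matrix on the multiplicity-one constituent `S^{(n−2|ν̄|, 2ν̄)}`) is
`≥ 0`; (B) from the zonal polynomials `Z_ν = J_ν^{(2)}` (Macdonald VII (2.3), (2.13), (2.23), VI (6.24)(ii), (7.9'),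
(7.14'), (10.22), (10.29)): `θ_ν̄(n) = ∏_{c ≤ ν̄₁} (n − 2j − 2c + 1 + h_c) / ∏_{i < j + ν̄₁} (n − 1 − 2i)`,
`j = |ν̄|`, `h_c` = column heights of `ν̄`, all of whose zeros and poles lie below `4j`, hence `θ_ν̄(n) > 0` for
`n ≥ 4j` — which gives the theorem for all odd `n`. Machine confirmation (exact integer arithmetic, independent of (B)):
for all 29 partitions `ν̄` with `|ν̄| ≤ 6` the Young-symmetrizer computation reproduces (B) exactly (cell files
`num/potechin/{theta,checkform}.py`, kit j288706), so the statement is verified by exact arithmetic alone for index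
degree `≤ 12` and every `n`, i.e. in full for all odd `n ≤ 27`. A kernel discharge would need `S_n`-isotypic
decompositions / Young symmetrizers and either zonal polynomials or an elementary proof of (B) — none in Mathlib today.
WHAT THIS IS NOT: not a proof of Potechin's theorem in the kernel; not an SOS refutation-degree statement (that is
`Mod2SosDegree`); nothing about psd rank; no P-vs-NP content.
-/

noncomputable section

open Finset

namespace Literature.Computability.Complexity.Mod2Story

variable {n : ℕ}

/-- The vertices mentioned by an edge set `G ⊆ Sym2 (Fin n)` — the index set `I(x_G)` of the monomial `x_G`, whose
size is its INDEX DEGREE. [cite: Potechin2019, Def. 2.11 (arXiv p. 5)] -/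
def verts (G : Finset (Sym2 (Fin n))) : Finset (Fin n) := univ.filter fun v => ∃ e ∈ G, v ∈ e

/-- Membership in `verts`. [cite: Potechin2019, Def. 2.11 (arXiv p. 5)] -/
theorem mem_verts {G : Finset (Sym2 (Fin n))} {v : Fin n} : v ∈ verts G ↔ ∃ e ∈ G, v ∈ e := by
  simp [verts]

/-- **Partial matchings of `K_n`** as edge sets: no loop `s(a, a)`, and every vertex lies on at most one edge.
[cite: Potechin2019, Example 3.4 (arXiv pp. 7–8: "if `E` is a partial matching")] -/
def IsPartialMatching (G : Finset (Sym2 (Fin n))) : Prop :=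
  (∀ e ∈ G, ¬ e.IsDiag) ∧ ∀ v : Fin n, (G.filter fun e => v ∈ e).card ≤ 1

/-- **The story moments of the MOD 2 principle** (Potechin's pseudo-expectation values for "`K_n` has a perfect
matching"): `Ẽ[x_G] = 1/∏_{j=1}^{|G|} (n − 2j + 1) = ∏_{j<|G|} (n − 1 − 2j)⁻¹` if `G` is a partial matching, and `0`
otherwise. [cite: Potechin2019, Example 3.4 (arXiv p. 8, displayed formula)] -/
def storyMoment (n : ℕ) (G : Finset (Sym2 (Fin n))) : ℝ := by
  classical
  exact if IsPartialMatching G then (∏ j ∈ range G.card, ((n : ℝ) - 1 - 2 * j))⁻¹ else 0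

/-- Unfolding on a partial matching. [cite: Potechin2019, Example 3.4 (arXiv p. 8)] -/
theorem storyMoment_of_isPartialMatching {G : Finset (Sym2 (Fin n))} (h : IsPartialMatching G) :
    storyMoment n G = (∏ j ∈ range G.card, ((n : ℝ) - 1 - 2 * j))⁻¹ := by
  unfold storyMoment
  exact if_pos h

/-- Unfolding off partial matchings. [cite: Potechin2019, Example 3.4 (arXiv p. 8: "and `0` otherwise")] -/
theorem storyMoment_of_not_isPartialMatching {G : Finset (Sym2 (Fin n))} (h : ¬ IsPartialMatching G) :
    storyMoment n G = 0 := by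
  unfold storyMoment
  exact if_neg h

/-- The empty edge set is a partial matching. [cite: Potechin2019, Def. 2.14 (1)] -/
theorem isPartialMatching_empty : IsPartialMatching (∅ : Finset (Sym2 (Fin n))) := by
  constructor
  · intro e he; simp at he
  · intro v; simp

/-- `Ẽ[1] = 1` (Def. 2.14 (1)): the empty monomial has story moment `1`. [cite: Potechin2019, Def. 2.14 (1) (arXiv p. 6)] -/
theorem storyMoment_empty (n : ℕ) : storyMoment n (∅ : Finset (Sym2 (Fin n))) = 1 := by
  rw [storyMoment_of_isPartialMatching isPartialMatching_empty]
  simp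

/-- A single (non-loop) edge is a partial matching. [cite: Potechin2019, Example 3.4 (arXiv p. 7)] -/
theorem isPartialMatching_singleton {a b : Fin n} (hab : a ≠ b) :
    IsPartialMatching ({s(a, b)} : Finset (Sym2 (Fin n))) := by
  constructor
  · intro e he
    rw [mem_singleton] at he
    subst he
    rwa [Sym2.mk_isDiag_iff]
  · intro v
    exact (card_le_card (filter_subset _ _)).trans (card_singleton _).le

/-- **Example 3.4**: `Ẽ[x_{ij}] = 1/(n − 1)` ("the adversary wants to match `1` out of the remaining `n − 1` vertices
with `i`"). [cite: Potechin2019, Example 3.4 (arXiv p. 7)] -/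
theorem storyMoment_singleton {a b : Fin n} (hab : a ≠ b) :
    storyMoment n ({s(a, b)} : Finset (Sym2 (Fin n))) = ((n : ℝ) - 1)⁻¹ := by
  rw [storyMoment_of_isPartialMatching (isPartialMatching_singleton hab), card_singleton]
  simp

/-- The vertex support of an edge set is the union of the (at most two-element) supports of its edges, so the index
degree of `x_G` is at most twice its degree: `|verts G| ≤ 2|G|`. [cite: Potechin2019, Example 2.12 (arXiv p. 5:
"`x_{12}x_{34}` has degree 2 and index degree 4")] -/
theorem card_verts_le_two_mul (G : Finset (Sym2 (Fin n))) : (verts G).card ≤ 2 * G.card := by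
  classical
  have hsub : verts G ⊆ G.biUnion fun e => univ.filter fun v : Fin n => v ∈ e := by
    intro v hv
    obtain ⟨e, he, hve⟩ := mem_verts.1 hv
    exact mem_biUnion.2 ⟨e, he, mem_filter.2 ⟨mem_univ _, hve⟩⟩
  have htwo : ∀ e : Sym2 (Fin n), (univ.filter fun v : Fin n => v ∈ e).card ≤ 2 := by
    intro e
    induction e using Sym2.ind with
    | h a b =>
      have : (univ.filter fun v : Fin n => v ∈ s(a, b)) ⊆ {a, b} := by
        intro v hv
        rw [mem_filter, Sym2.mem_iff] at hv
        rcases hv.2 with rfl | rfl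
        · exact mem_insert_self _ _
        · exact mem_insert_of_mem (mem_singleton_self _)
      exact (card_le_card this).trans (card_insert_le _ _)
  calc (verts G).card ≤ (G.biUnion fun e => univ.filter fun v : Fin n => v ∈ e).card := card_le_card hsub
    _ ≤ ∑ e ∈ G, (univ.filter fun v : Fin n => v ∈ e).card := card_biUnion_le
    _ ≤ ∑ _e ∈ G, 2 := sum_le_sum fun e _ => htwo e
    _ = 2 * G.card := by rw [sum_const, smul_eq_mul, mul_comm]

/-! ## The named fact -/

/-- **Potechin 2019, Theorem 1.2 / Corollary 3.10 (moment-matrix form).** For every ODD `n`, the story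
pseudo-expectation of the MOD 2 principle — `Ẽ[x_G] = storyMoment n G = [G a partial matching]·∏_{j<|G|}(n − 1 − 2j)⁻¹`
— is positive semidefinite on polynomials of index degree `≤ n/2`: for every real coefficient vector `δ` on edge sets
`G ⊆ E(K_n)` supported on index degree `≤ (n − 1)/2` (`2·|verts G| ≤ n − 1` whenever `δ_G ≠ 0`),
`0 ≤ Σ_{G, G'} δ_G δ_{G'} · storyMoment n (G ∪ G')` (`= Ẽ[g²]`, `g = Σ_G δ_G x_G`; Def. 2.14 (3), Remark 2.16).
Printed: "Degree `(n−1)/2` SOS fails to prove that the equations for the MOD 2 principle are infeasible" (Thm 1.2);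
"For all odd `n`, index degree `n` SOS fails to refute the equations for the MOD 2 principle" (Cor. 3.10, Cor. 6.11),
established by exhibiting these index-degree-`n` pseudo-expectation values (Thm 6.10: a level `(⌊n/2⌋ + 1, n)` good
story; Thm 5.12). NAMED FACT, not proved in the tree. STATUS (2026-08-27, see the module docstring): the printed
proof is incomplete (its Lemma 5.13 is false; the printed argument covers index degree `≤ n/3` only); the statement is
true — repaired proof (rank-one reduction over the Gelfand pair `(S_{2a}, B_a)` + the zonal-polynomial eigenvalue
identity `θ_ν̄(n) = ∏_{c≤ν̄₁}(n−2|ν̄|−2c+1+h_c)/∏_{i<|ν̄|+ν̄₁}(n−1−2i) > 0` for `n ≥ 4|ν̄|`) in the cell memo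
`pnp-psdrank-lit/LIT-28.md`, machine-checked by exact arithmetic for all odd `n ≤ 27` and for index degree `≤ 12` at
every `n`.
-- TODO(general form): Def. 2.14 in full (all `g` of index degree `≤ n/2`, and the annihilation of the ideal).
[cite: Potechin2019, Thm. 1.2 (61:4), Example 3.4 (61:7–8), Cor. 3.10 (61:9), Thm. 6.10 / Cor. 6.11 (61:16)] -/
def Potechin2019_mod2StoryPSD : Prop :=
  ∀ (n : ℕ), Odd n → ∀ δ : Finset (Sym2 (Fin n)) → ℝ,
    (∀ G, δ G ≠ 0 → 2 * (verts G).card ≤ n - 1) →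
    0 ≤ ∑ G, ∑ G', δ G * δ G' * storyMoment n (G ∪ G')

/-- **The consumer's form: degree `k` with `4k + 1 ≤ n`.** For odd `n` and `4k + 1 ≤ n`, the story moment form is
nonnegative on EVERY coefficient vector indexed by the edge sets of size `≤ k` (a multilinear polynomial of degree
`≤ k` in the edge variables has index degree `≤ 2k ≤ (n − 1)/2`). This is the one-clique hypothesis shape of the
cell's matching-side low-degree pricing (`…ChebyshevTracialDesignPseudoMatchingTensor`, up to relabelling the clique).
[cite: Potechin2019, Thm. 1.2 and Cor. 3.10 (61:4, 61:9)] -/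
theorem Potechin2019_mod2StoryPSD.of_card_le (h : Potechin2019_mod2StoryPSD) {n k : ℕ} (hn : Odd n)
    (hk : 4 * k + 1 ≤ n) (δ : {F : Finset (Sym2 (Fin n)) // F.card ≤ k} → ℝ) :
    0 ≤ ∑ A, ∑ A', δ A * δ A' * storyMoment n (A.1 ∪ A'.1) := by
  classical
  -- extend `δ` by zero to all edge sets
  set δ' : Finset (Sym2 (Fin n)) → ℝ := fun F => if hF : F.card ≤ k then δ ⟨F, hF⟩ else 0 with hδ'
  have hidx : ∀ G, δ' G ≠ 0 → 2 * (verts G).card ≤ n - 1 := by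
    intro G hG
    have hGk : G.card ≤ k := by
      by_contra hc
      exact hG (by simp [hδ', hc])
    have := card_verts_le_two_mul G
    omega
  have key := h n hn δ' hidx
  -- the zero-extended double sum is the double sum over the subtype
  have hval : ∀ A : {F : Finset (Sym2 (Fin n)) // F.card ≤ k}, δ' A.1 = δ A := by
    intro A; simp [hδ', A.2]
  have hmem : ∀ F : Finset (Sym2 (Fin n)), F ∈ univ.filter (fun F : Finset (Sym2 (Fin n)) => F.card ≤ k) ↔ F.card ≤ k :=
    fun F => by simp
  have hinner : ∀ G : Finset (Sym2 (Fin n)),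
      ∑ G', δ' G * δ' G' * storyMoment n (G ∪ G') = ∑ A' : {F : Finset (Sym2 (Fin n)) // F.card ≤ k},
        δ' G * δ A' * storyMoment n (G ∪ A'.1) := by
    intro G
    rw [← sum_filter_of_ne (p := fun F : Finset (Sym2 (Fin n)) => F.card ≤ k)
      (fun F _ hF => by by_contra hc; exact hF (by simp [hδ', hc])), sum_subtype (F := inferInstance) _ hmem]
    exact sum_congr rfl fun A' _ => by rw [hval A']
  have houter : ∑ G, ∑ G', δ' G * δ' G' * storyMoment n (G ∪ G') =
      ∑ A : {F : Finset (Sym2 (Fin n)) // F.card ≤ k}, ∑ A' : {F : Finset (Sym2 (Fin n)) // F.card ≤ k},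
        δ A * δ A' * storyMoment n (A.1 ∪ A'.1) := by
    simp_rw [hinner]
    rw [← sum_filter_of_ne (p := fun F : Finset (Sym2 (Fin n)) => F.card ≤ k)
      (fun F _ hF => by
        by_contra hc
        exact hF (sum_eq_zero fun A' _ => by simp [hδ', hc])), sum_subtype (F := inferInstance) _ hmem]
    exact sum_congr rfl fun A _ => by simp_rw [hval A]
  rw [houter] at key
  exact key

end Literature.Computability.Complexity.Mod2Story
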